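/-
Copyright (c) 2026. All rights reserved.
Released under Apache 2.0 license as described in the file LICENSE.
-/
import Mathlib
import HarnessLib

/-!
# Contamination ledger of a scale cascade (class L-OUT bookkeeping)

HONEST FRAMING (cell `pub-fluidc`, blueprint seat bp3, gen 24): low prior, high value-of-information
experiment on Tao's machine paradigm; NOT a claim that NS blows up. Nothing here concerns
Navier–Stokes; these are the elementary real-arithmetic facts that turn a PER-WINDOW tolerance of
the toy machine to "leak through outside modes" (bp2 COUPLING-MODEL v0.1, class L-out; measured at
twin level in R1-DESIGN §13) into statements about the WHOLE cascade.

DICTIONARY (R1-DESIGN §13.5). Window `n` of the machine carries energy `E n` in its nine designed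
modes and INHERITS an outside contamination of relative amplitude `x n` (outside amplitude at the
scales the window is sensitive to, divided by `√(E n)`).  A true-NS realisation cannot switch off
the triads with a leg outside the designed set.  Two facts about one window are taken as the
interface axiom (L-out), both certified for the toy chain only as TOLERANCES of the induction step:
* reservoir leak (class LO): from rest, the window deposits a fresh outside amplitude `≤ b` relative
  to the next window and loses energy `≤ lam · E n`, while the induction box still closes, for every
  family of leak couplings with `ℓ²`-sum `≤ θ_LO²`;
* parametric amplification (class LX): an inherited contamination `x n ≤ z` is amplified by at most
  `A = exp (θ_LX · w · J)` during the window while the induction box still closes; of the amplified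
  contamination only the fraction `β` (SPECTRAL LOCALITY DISCOUNT — the part sitting at the scales
  window `n+1` is sensitive to) is inherited, and window `n+1` measures it against its own, smaller,
  energy `E (n+1) = lev² · E n`: `x (n+1) ≤ a · x n + b` with `a = β · A / lev`.
The theorems: the contamination invariant `x n ≤ z` propagates through every window iff the budget
closes, `a · z + b ≤ z` (`invariant`); the smallest closing budget is `b / (1 - a)` and it exists
iff `a < 1` (`fixedPoint_closes`, `le_of_closes`, `no_budget`): WITHOUT a spectral-locality discount
(`β · A ≥ lev`, i.e. `a ≥ 1`) no tolerance whatsoever survives the cascade, and the worst case then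
grows at least linearly (`diverges`).  The leaked energy, a fixed fraction per window of a
geometrically decreasing budget, is summable (`outsideEnergy_le`): energy LOSS to outside modes is
an efficiency condition, not an obstruction.  `ledger` bundles the three conclusions.
-/

namespace Summit.NavierStokesRegularity.FluidComputer.ContaminationLedger

/-- THE CONTAMINATION INVARIANT.  If every window that starts within tolerance (`x n ≤ z`) hands
over a contamination `≤ a · x n + b` (`a ≥ 0`: discounted parametric gain, `b`: fresh reservoir
leak), and the budget closes (`a · z + b ≤ z`), then every window starts within tolerance. -/
theorem invariant {x : ℕ → ℝ} {a b z : ℝ} (ha : 0 ≤ a) (hz : a * z + b ≤ z) (h0 : x 0 ≤ z)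
    (hstep : ∀ n, x n ≤ z → x (n + 1) ≤ a * x n + b) : ∀ n, x n ≤ z := by
  intro n
  induction n with
  | zero => exact h0
  | succ n ih =>
    have h1 := hstep n ih
    have h2 : a * x n ≤ a * z := mul_le_mul_of_nonneg_left ih ha
    linarith

/-- The smallest closing budget: for `a < 1` the level `b / (1 - a)` closes the budget exactly. -/
theorem fixedPoint_closes {a b : ℝ} (ha : a < 1) : a * (b / (1 - a)) + b = b / (1 - a) := by
  have h : (1 - a) ≠ 0 := by linarith
  field_simp
  ring

/-- … and it is minimal: every closing budget is at least `b / (1 - a)`. -/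
theorem le_of_closes {a b z : ℝ} (ha : a < 1) (hz : a * z + b ≤ z) : b / (1 - a) ≤ z := by
  have h : 0 < 1 - a := by linarith
  rw [div_le_iff₀ h]
  nlinarith

/-- NO DISCOUNT, NO BUDGET.  If the discounted gain is `≥ 1` and the fresh leak is positive, no
non-negative tolerance closes the budget: a spectral-locality discount `β < lev / A` is NECESSARY
for any realisation of the cascade with parametric leak couplings. -/
theorem no_budget {a b z : ℝ} (ha : 1 ≤ a) (hb : 0 < b) (hz : 0 ≤ z) : ¬ a * z + b ≤ z := by
  intro h
  nlinarith

/-- … and the worst case then diverges at least linearly: if some realisation attains the bound from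
below (`a · x n + b ≤ x (n+1)`) with `a ≥ 1`, `b ≥ 0`, `x 0 ≥ 0`, then `x n ≥ n · b`. -/
theorem diverges {x : ℕ → ℝ} {a b : ℝ} (ha : 1 ≤ a) (hb : 0 ≤ b) (h0 : 0 ≤ x 0)
    (hstep : ∀ n, a * x n + b ≤ x (n + 1)) : ∀ n : ℕ, (n : ℝ) * b ≤ x n := by
  intro n
  induction n with
  | zero => simpa using h0
  | succ n ih =>
    have h1 := hstep n
    have hx : 0 ≤ x n := le_trans (by positivity) ih
    have h2 : x n ≤ a * x n := by nlinarith
    push_cast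
    linarith

/-- LEAKED ENERGY IS SUMMABLE.  If window `n` deposits at most `lam · E n` into outside modes
(`e (n+1) ≤ e n + lam · E n`) and the designed energy contracts geometrically
(`E (n+1) ≤ eta · E n`, `eta < 1`, `E n ≥ 0`), then the outside energy never exceeds
`e 0 + lam · E 0 / (1 - eta)` — via the non-increasing potential `e n + lam/(1-eta) · E n`. -/
theorem outsideEnergy_le {e E : ℕ → ℝ} {lam eta : ℝ} (hlam : 0 ≤ lam) (heta : eta < 1)
    (hE : ∀ n, 0 ≤ E n) (hEstep : ∀ n, E (n + 1) ≤ eta * E n)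
    (hestep : ∀ n, e (n + 1) ≤ e n + lam * E n) : ∀ n, e n ≤ e 0 + lam * E 0 / (1 - eta) := by
  have h1 : 0 < 1 - eta := by linarith
  -- the potential Φ n = e n + lam / (1 - eta) * E n is non-increasing
  have hpot : ∀ n, e (n + 1) + lam / (1 - eta) * E (n + 1) ≤ e n + lam / (1 - eta) * E n := by
    intro n
    have hc : 0 ≤ lam / (1 - eta) := div_nonneg hlam h1.le
    have h2 : lam / (1 - eta) * E (n + 1) ≤ lam / (1 - eta) * (eta * E n) :=
      mul_le_mul_of_nonneg_left (hEstep n) hc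
    have h3 : lam * E n + lam / (1 - eta) * (eta * E n) = lam / (1 - eta) * E n := by
      field_simp
      ring
    linarith [hestep n]
  have hmono : ∀ n, e n + lam / (1 - eta) * E n ≤ e 0 + lam / (1 - eta) * E 0 := by
    intro n
    induction n with
    | zero => exact le_refl _
    | succ n ih => exact le_trans (hpot n) ih
  intro n
  have h4 : 0 ≤ lam / (1 - eta) * E n := mul_nonneg (div_nonneg hlam h1.le) (hE n)
  have h5 : lam * E 0 / (1 - eta) = lam / (1 - eta) * E 0 := by ring
  linarith [hmono n]

/-- THE LEDGER (conjunction).  Under the window axiom (L-out) — every window starting within the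
contamination tolerance `z` closes its induction box, hands over contamination `≤ a · x n + b` and
outside energy `≤ e n + lam · E n`, with designed energy contracting by `eta < 1` — and a CLOSING
BUDGET `a · z + b ≤ z` with `x 0 ≤ z`: every window starts within tolerance (so the window axiom
applies to all of them), and the total outside energy stays `≤ e 0 + lam · E 0 / (1 - eta)`. -/
theorem ledger {x e E : ℕ → ℝ} {a b z lam eta : ℝ} (ha : 0 ≤ a) (hz : a * z + b ≤ z)
    (h0 : x 0 ≤ z) (hlam : 0 ≤ lam) (heta : eta < 1) (hE : ∀ n, 0 ≤ E n)
    (hEstep : ∀ n, E (n + 1) ≤ eta * E n)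
    (hwin : ∀ n, x n ≤ z → x (n + 1) ≤ a * x n + b ∧ e (n + 1) ≤ e n + lam * E n) :
    (∀ n, x n ≤ z) ∧ ∀ n, e n ≤ e 0 + lam * E 0 / (1 - eta) := by
  have hx : ∀ n, x n ≤ z := invariant ha hz h0 (fun n hn => (hwin n hn).1)
  exact ⟨hx, outsideEnergy_le hlam heta hE hEstep (fun n => (hwin n (hx n)).2)⟩

end Summit.NavierStokesRegularity.FluidComputer.ContaminationLedger
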